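import Mathlib
import Summits.Schanuel.Schanuel.Theses.RigidCore
import Summits.Schanuel.Schanuel.Theses.GaussianStokesSector

/-!
# Line `sector-split` (route `RigidCore`): residue 2 from item stmt-Schanuel-9548

Registered stub `stub_coreRel_of_relSchanuel` of line `sector-split` of crux `stmt-Schanuel-0970`
(`Summit.Schanuel.Schanuel.Theses.RigidCore.SchanuelOnLogFreeCore`, (R) = Schanuel's conjecture for
`ℚ`-linearly independent tuples from the log-free core
`C_EA = sInf {K ≤ ℂ | 2πi ∈ K, K exp-closed, K relatively algebraically closed}`).

Residue 2 of line `sector-split` — relative Schanuel over the π–LW field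
`K₂ = ℚ(ℚ̄ ∪ {πi} ∪ e^{ℚ̄})` for CORE tuples free modulo `V₂ = span_ℚ(ℚ̄ ∪ {πi})` — is the
restriction of item stmt-Schanuel-9548 `GaussianStokesSector.RelSchanuelOverPiLWField` (shared by
routes ExceptionalSubspaces / GaussianStokesSector / SingularModulusScaling) to core tuples: the item
asserts the same conclusion for ALL tuples free modulo `V₂`, so the core-membership hypothesis is
simply dropped.  The proof is definitional unfolding; no new definitions.
-/

noncomputable section

namespace Summit.Schanuel.Schanuel.Theorems.RigidCore

open Summit.Schanuel.Schanuel.Theses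

/-- **Registered stub `stub_coreRel_of_relSchanuel` of line `sector-split`** (signature verbatim):
residue 2 (relative Schanuel over the π–LW field `K₂ = ℚ(ℚ̄ ∪ {πi} ∪ e^{ℚ̄})` for core tuples that
are `ℚ`-linearly independent modulo `V₂ = span_ℚ(ℚ̄ ∪ {πi})`) is implied by item stmt-Schanuel-9548
`GaussianStokesSector.RelSchanuelOverPiLWField`, which is the same statement without the
core-membership hypothesis.  Proof: unfold the item and forget the core hypothesis. [folklore] -/
theorem stub_coreRel_of_relSchanuel :
    GaussianStokesSector.RelSchanuelOverPiLWField →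
    ∀ (n : ℕ) (x : Fin n → ℂ),
      (∀ i, x i ∈ (sInf {K : IntermediateField ℚ ℂ | (2 * ↑Real.pi * Complex.I : ℂ) ∈ K ∧
        (∀ w ∈ K, Complex.exp w ∈ K) ∧ ∀ w : ℂ, IsAlgebraic K w → w ∈ K} : IntermediateField ℚ ℂ)) →
      LinearIndependent ℚ ((Submodule.span ℚ ({z : ℂ | IsAlgebraic ℚ z} ∪ {(Real.pi : ℂ) * Complex.I})).mkQ ∘ x) →
      (n : Cardinal) ≤ Algebra.trdeg
        ↥(IntermediateField.adjoin ℚ ({z : ℂ | IsAlgebraic ℚ z} ∪ {(Real.pi : ℂ) * Complex.I} ∪ Complex.exp '' {z : ℂ | IsAlgebraic ℚ z}))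
        ↥(IntermediateField.adjoin ↥(IntermediateField.adjoin ℚ ({z : ℂ | IsAlgebraic ℚ z} ∪ {(Real.pi : ℂ) * Complex.I} ∪ Complex.exp '' {z : ℂ | IsAlgebraic ℚ z})) (Set.range x ∪ Set.range (Complex.exp ∘ x))) := by
  intro h n x _ hli
  exact h n x hli

end Summit.Schanuel.Schanuel.Theorems.RigidCore

end
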